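import Literature.Probability.Percolation.InterfaceScalingLimit
import Literature.Barriers.CriticalPhenomena.SupercriticalSAWSpaceFillingSteps
import HarnessLib

/-!
# The canonical square-lattice discretisation of the unit disc is admissible at no mesh

Topic `Probability/Percolation`; evidence file accompanying the statement concern on
crit-perc.S02 (`Literature.Probability.Percolation.SLE6LimitZ2`, `InterfaceScalingLimit.lean`)
recorded in `InterfaceScalingLimitDiscretised.lean`. `SLE6LimitZ2` (and the tightness facts
`isTightLaws_map_bondInterface`, crit-perc.S26) quantify over Dobrushin domains `D` under the
guard `∀ᶠ δ in 𝓝[>] 0, (dobrushinData D δ).IsZdAdmissible` on G02's canonical discrete Dobrushin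
data `dobrushinData D δ = ⟨D, δ, (ab), (ba)⟩`. We prove that for the library's only closed-form
Dobrushin domain, `DobrushinDomain.unitDisc` (marked points `1`, `-1`; arcs the upper and lower
half circles), the guard fails — indeed the canonical data are admissible at **no** mesh
(`not_isZdAdmissible_dobrushinData_unitDisc`), so that `SLE6LimitZ2` holds *vacuously* at the
unit disc (`sle6LimitZ2_unitDisc_vacuous`). This turns the remark of review r02345B (item 1),
quoted in the module docstring of `Literature/Probability/LatticeModels/InterfaceSLE.lean`, into
a theorem.

## The argument (tie sites of `zdDiscreteArc`)

The discrete arcs `zdArcA`, `zdArcB` of the data are the sites of the square-lattice boundary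
`zdBoundary` at least as close to `(ab)` as to `∂Ω ∖ (ab)`, resp. to `(ba)` as to `∂Ω ∖ (ba)`
(`DiscreteDobrushin.zdDiscreteArc`, comparison with `≤`), and `IsZdAdmissible.disjoint` asks
them to be disjoint. Let `δ > 0` and let `v_δ = (⌈1/δ⌉ - 1, 0)` be the last site of `δℤ²` on the
non-negative real axis inside the disc (notation `(![⌈δ⁻¹⌉ - 1, 0] : Site 2)` below), with abscissa
`r_δ = δ (⌈1/δ⌉ - 1) ∈ [0, 1)` (notation `(δ * ((⌈δ⁻¹⌉ - 1 : ℤ) : ℝ))`). Its right neighbour has abscissa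
`δ ⌈1/δ⌉ ≥ 1`, hence lies outside the disc, so `v_δ ∈ meshBoundary ⊆ zdBoundary` (the discrete
disc `𝔻_δ` is all of `𝔻 ∩ δℤ²`, `SupercriticalSAW.mem_meshDomain_unitDisk` from
`Literature/Barriers/CriticalPhenomena/SupercriticalSAWSpaceFillingSteps.lean`, reused rather
than re-proved). Both closed arcs contain the marked point `1`, so both are at distance
`≤ 1 - r_δ` from `r_δ`; and every point of the unit circle is at distance `≥ 1 - r_δ` from `r_δ`,
so both complements `∂𝔻 ∖ (ab)`, `∂𝔻 ∖ (ba)` (non-empty: `∓i`) are at distance `≥ 1 - r_δ`.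
Hence `v_δ` lies in both discrete arcs: a tie, at every mesh. (For `δ ≤ 0` admissibility fails
by `delta_pos`.) The same mechanism — a boundary site on the equidistance locus of the two arcs —
defeats the guard along meshes `δ_k → 0⁺` for axis-aligned rectangles and for marked points in
general position (see `InterfaceScalingLimitDiscretised.lean`); only the disc is formalised here.

## References

* S. Smirnov, *Critical percolation in the plane*, C. R. Acad. Sci. Paris 333 (2001), §2 (discrete
  arcs as the boundary vertices closest to the continuum arcs — the recipe of `discreteArc`).
* Review r02345B, item 1 (H21 ledger), on crit-ising.S17.
-/

noncomputable section

open MeasureTheory Filter Topology Metric Set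
open scoped Real

namespace Literature.Probability.Percolation

section CritPerc

open LatticeModels RandomPlanarGeometry
open Literature.Barriers.CriticalPhenomena

/-- The first mark of the unit disc Dobrushin domain is the parameter `0`. [folklore] -/
theorem unitDisc_mark_zero : DobrushinDomain.unitDisc.mark 0 = 0 := rfl

/-- The second mark of the unit disc Dobrushin domain is the parameter `1/2`. [folklore] -/
theorem unitDisc_mark_one : DobrushinDomain.unitDisc.mark 1 = 1 / 2 := rfl

/-- The boundary loop of the unit disc is `t ↦ exp (2πit)`. [folklore] -/
theorem unitDisc_boundary (t : ℝ) :
    DobrushinDomain.unitDisc.boundary t = circleMap 0 1 (2 * π * t) := rfl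

/-- The carrier of the unit disc Dobrushin domain is the open unit ball. [folklore] -/
theorem unitDisc_carrier : DobrushinDomain.unitDisc.carrier = ball (0 : ℂ) 1 := rfl

/-- The mark after the first one is `1/2`. [folklore] -/
theorem unitDisc_nextMark_zero : DobrushinDomain.unitDisc.nextMark 0 = 1 / 2 := by
  simp [MarkedDomain.nextMark, unitDisc_mark_one]

/-- The mark after the second one is `0 + 1 = 1` (cyclically, shifted by the period). [folklore] -/
theorem unitDisc_nextMark_one : DobrushinDomain.unitDisc.nextMark 1 = 1 := by
  simp [MarkedDomain.nextMark, unitDisc_mark_zero]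

/-- The first marked point of the unit disc is `a = 1`. [folklore] -/
theorem unitDisc_pt_zero : DobrushinDomain.unitDisc.pt 0 = 1 := by
  simp [MarkedDomain.pt, unitDisc_boundary, unitDisc_mark_zero, circleMap]

/-- The marked point `1` lies on both closed boundary arcs of the unit disc (it is an endpoint
of each). [folklore] -/
theorem one_mem_unitDisc_arc (i : Fin 2) : (1 : ℂ) ∈ DobrushinDomain.unitDisc.arc i := by
  fin_cases i
  · simpa [unitDisc_pt_zero] using DobrushinDomain.unitDisc.pt_mem_arc_self 0
  · have h := DobrushinDomain.unitDisc.pt_succ_mem_arc 1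
    rw [show (1 : Fin 2) + 1 = 0 from rfl, unitDisc_pt_zero] at h
    simpa using h

/-- The frontier of the unit disc is the unit circle. [folklore] -/
theorem frontier_unitDisc_carrier :
    frontier DobrushinDomain.unitDisc.carrier = sphere (0 : ℂ) 1 := by
  rw [unitDisc_carrier, frontier_ball (0 : ℂ) one_ne_zero]

/-- The arc `(ab)` of the unit disc is the closed upper half circle `{exp (2πit) : t ∈ [0, 1/2]}`.
[folklore] -/
theorem unitDisc_arc_zero :
    DobrushinDomain.unitDisc.arc 0 = (fun t : ℝ ↦ circleMap 0 1 (2 * π * t)) '' Icc (0 : ℝ) (1 / 2) := by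
  rw [MarkedDomain.arc, unitDisc_nextMark_zero, unitDisc_mark_zero]
  rfl

/-- The arc `(ba)` of the unit disc is the closed lower half circle `{exp (2πit) : t ∈ [1/2, 1]}`.
[folklore] -/
theorem unitDisc_arc_one :
    DobrushinDomain.unitDisc.arc 1 = (fun t : ℝ ↦ circleMap 0 1 (2 * π * t)) '' Icc (1 / 2 : ℝ) 1 := by
  rw [MarkedDomain.arc, unitDisc_nextMark_one, unitDisc_mark_one]
  rfl

/-- The boundary loop of the unit disc is injective on one period. [folklore] -/
theorem unitDisc_injOn :
    InjOn (fun t : ℝ ↦ circleMap 0 1 (2 * π * t)) (Ico (0 : ℝ) 1) :=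
  JordanDomain.unitDisc.injOn_boundary

/-- The point `-i = exp (2πi · 3/4)` of the circle is not on the upper arc `(ab)`. [folklore] -/
theorem circleMap_three_quarters_not_mem_arc_zero :
    circleMap 0 1 (2 * π * (3 / 4 : ℝ)) ∉ DobrushinDomain.unitDisc.arc 0 := by
  rw [unitDisc_arc_zero]
  rintro ⟨s, hs, h⟩
  have hs' : s = 3 / 4 :=
    unitDisc_injOn ⟨hs.1, by linarith [hs.2]⟩ ⟨by norm_num, by norm_num⟩ h
  linarith [hs.2]

/-- The point `i = exp (2πi / 4)` of the circle is not on the lower arc `(ba)`. [folklore] -/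
theorem circleMap_quarter_not_mem_arc_one :
    circleMap 0 1 (2 * π * (1 / 4 : ℝ)) ∉ DobrushinDomain.unitDisc.arc 1 := by
  rw [unitDisc_arc_one]
  rintro ⟨s, hs, h⟩
  rcases hs.2.lt_or_eq with hs1 | rfl
  · have hs' : s = 1 / 4 :=
      unitDisc_injOn ⟨by linarith [hs.1], hs1⟩ ⟨by norm_num, by norm_num⟩ h
    linarith [hs.1]
  · have h1 : circleMap 0 1 (2 * π * (1 : ℝ)) = circleMap 0 1 (2 * π * (0 : ℝ)) := by
      simp [circleMap]
    have h0 : (fun t : ℝ ↦ circleMap 0 1 (2 * π * t)) 0 = (fun t : ℝ ↦ circleMap 0 1 (2 * π * t)) (1 / 4) := by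
      simp only
      rw [← h1]
      exact h
    have : (0 : ℝ) = 1 / 4 := unitDisc_injOn ⟨le_rfl, by norm_num⟩ ⟨by norm_num, by norm_num⟩ h0
    norm_num at this

/-- Each complementary boundary part `∂𝔻 ∖ arc i` is non-empty (witnesses `-i`, `i`), so that
the distance comparisons in `zdDiscreteArc` are not the junk `infDist _ ∅ = 0`. [folklore] -/
theorem nonempty_frontier_diff_unitDisc_arc (i : Fin 2) :
    (frontier DobrushinDomain.unitDisc.carrier \ DobrushinDomain.unitDisc.arc i).Nonempty := by
  rw [frontier_unitDisc_carrier]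
  fin_cases i
  · exact ⟨_, circleMap_mem_sphere 0 zero_le_one _, circleMap_three_quarters_not_mem_arc_zero⟩
  · exact ⟨_, circleMap_mem_sphere 0 zero_le_one _, circleMap_quarter_not_mem_arc_one⟩

/-- The mesh point of the last real site is the real number `r_δ`. [folklore] -/
theorem meshPoint_lastRealSite (δ : ℝ) :
    meshPoint δ ((![⌈δ⁻¹⌉ - 1, 0] : Site 2)) = (↑((δ * ((⌈δ⁻¹⌉ - 1 : ℤ) : ℝ))) : ℂ) := by
  apply Complex.ext
  · simp
  · simp

/-- `0 ≤ r_δ` for `δ > 0` (as `⌈1/δ⌉ ≥ 1`). [folklore] -/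
theorem lastRealAbscissa_nonneg {δ : ℝ} (hδ : 0 < δ) : 0 ≤ (δ * ((⌈δ⁻¹⌉ - 1 : ℤ) : ℝ)) := by
  have h1 : (1 : ℤ) ≤ ⌈δ⁻¹⌉ := Int.one_le_ceil_iff.2 (inv_pos.2 hδ)
  have h2 : (0 : ℝ) ≤ ((⌈δ⁻¹⌉ - 1 : ℤ) : ℝ) := by exact_mod_cast (by omega : (0 : ℤ) ≤ ⌈δ⁻¹⌉ - 1)
  exact mul_nonneg hδ.le h2

/-- `r_δ < 1` for `δ > 0` (as `⌈1/δ⌉ - 1 < 1/δ`): the last real site is inside the disc. [folklore] -/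
theorem lastRealAbscissa_lt_one {δ : ℝ} (hδ : 0 < δ) : (δ * ((⌈δ⁻¹⌉ - 1 : ℤ) : ℝ)) < 1 := by
  have h1 : ((⌈δ⁻¹⌉ - 1 : ℤ) : ℝ) < δ⁻¹ := by
    have := Int.ceil_lt_add_one δ⁻¹
    push_cast
    linarith
  calc δ * ((⌈δ⁻¹⌉ - 1 : ℤ) : ℝ) < δ * δ⁻¹ := mul_lt_mul_of_pos_left h1 hδ
    _ = 1 := mul_inv_cancel₀ hδ.ne'

/-- `1 ≤ δ ⌈1/δ⌉` for `δ > 0`: the right neighbour of the last real site is outside the disc.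
[folklore] -/
theorem one_le_mul_ceil_inv {δ : ℝ} (hδ : 0 < δ) : 1 ≤ δ * ((⌈δ⁻¹⌉ : ℤ) : ℝ) := by
  have h1 : δ⁻¹ ≤ ((⌈δ⁻¹⌉ : ℤ) : ℝ) := Int.le_ceil _
  calc (1 : ℝ) = δ * δ⁻¹ := (mul_inv_cancel₀ hδ.ne').symm
    _ ≤ δ * ((⌈δ⁻¹⌉ : ℤ) : ℝ) := mul_le_mul_of_nonneg_left h1 hδ.le

/-- The last real site is at distance `r_δ` from the centre. [folklore] -/
theorem norm_meshPoint_lastRealSite {δ : ℝ} (hδ : 0 < δ) :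
    ‖meshPoint δ ((![⌈δ⁻¹⌉ - 1, 0] : Site 2))‖ = (δ * ((⌈δ⁻¹⌉ - 1 : ℤ) : ℝ)) := by
  rw [meshPoint_lastRealSite, Complex.norm_real, Real.norm_of_nonneg (lastRealAbscissa_nonneg hδ)]

/-- The last real site belongs to the discrete disc `𝔻_δ = meshDomain 𝔻 δ` (which is all of
`𝔻 ∩ δℤ²`, `SupercriticalSAW.mem_meshDomain_unitDisk`). [folklore] -/
theorem lastRealSite_mem_meshDomain {δ : ℝ} (hδ : 0 < δ) :
    (![⌈δ⁻¹⌉ - 1, 0] : Site 2) ∈ meshDomain (ball (0 : ℂ) 1) δ := by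
  have h : (![⌈δ⁻¹⌉ - 1, 0] : Site 2) ∈ meshDomain SupercriticalSAW.unitDisk δ := by
    rw [SupercriticalSAW.mem_meshDomain_unitDisk, norm_meshPoint_lastRealSite hδ]
    exact lastRealAbscissa_lt_one hδ
  exact h

/-- The right neighbour of the last real site is not in the discrete disc (its abscissa is
`δ ⌈1/δ⌉ ≥ 1`). [folklore] -/
theorem lastRealSite_succ_not_mem_meshDomain {δ : ℝ} (hδ : 0 < δ) :
    (![⌈δ⁻¹⌉ - 1, 0] : Site 2) + Pi.single 0 1 ∉ meshDomain (ball (0 : ℂ) 1) δ := by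
  intro h
  have h' : ‖meshPoint δ ((![⌈δ⁻¹⌉ - 1, 0] : Site 2) + Pi.single 0 1)‖ < 1 :=
    (SupercriticalSAW.mem_meshDomain_unitDisk).1 h
  have hre : (meshPoint δ ((![⌈δ⁻¹⌉ - 1, 0] : Site 2) + Pi.single 0 1)).re = δ * ((⌈δ⁻¹⌉ : ℤ) : ℝ) := by
    rw [meshPoint_re, Pi.add_apply, Pi.single_eq_same]
    simp
  have h1 : (1 : ℝ) ≤ ‖meshPoint δ ((![⌈δ⁻¹⌉ - 1, 0] : Site 2) + Pi.single 0 1)‖ :=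
    (one_le_mul_ceil_inv hδ).trans (hre ▸ Complex.re_le_norm _)
  linarith

/-- Hence the last real site is a site of the square-lattice discrete boundary `zdBoundary` of the
canonical data of the unit disc (via `meshBoundary ⊆ zdBoundary`). (Smirnov 2001, §2, for the
notions.) [folklore] -/
theorem lastRealSite_mem_zdBoundary {δ : ℝ} (hδ : 0 < δ) :
    (![⌈δ⁻¹⌉ - 1, 0] : Site 2) ∈ (dobrushinData DobrushinDomain.unitDisc δ).zdBoundary :=
  (dobrushinData DobrushinDomain.unitDisc δ).meshBoundary_subset_zdBoundary
    (mem_meshBoundary_of_adj_not_mem (lastRealSite_mem_meshDomain hδ)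
      ((zdGraph_adj_iff _ _).2 ⟨0, Or.inl rfl⟩) (lastRealSite_succ_not_mem_meshDomain hδ))

/-- Both closed arcs are at distance `≤ 1 - r_δ` from the last real site (they contain `1`).
[folklore] -/
theorem infDist_lastRealSite_arc_le {δ : ℝ} (hδ : 0 < δ) (i : Fin 2) :
    infDist (meshPoint δ ((![⌈δ⁻¹⌉ - 1, 0] : Site 2))) (DobrushinDomain.unitDisc.arc i) ≤ 1 - (δ * ((⌈δ⁻¹⌉ - 1 : ℤ) : ℝ)) := by
  refine (infDist_le_dist_of_mem (one_mem_unitDisc_arc i)).trans_eq ?_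
  rw [meshPoint_lastRealSite, Complex.dist_eq, ← Complex.ofReal_one, ← Complex.ofReal_sub,
    Complex.norm_real, Real.norm_eq_abs, abs_sub_comm, abs_of_nonneg]
  linarith [lastRealAbscissa_lt_one hδ]

/-- Both complementary boundary parts are at distance `≥ 1 - r_δ` from the last real site (every
point of the unit circle is, by the reverse triangle inequality). [folklore] -/
theorem le_infDist_lastRealSite_frontier_diff {δ : ℝ} (hδ : 0 < δ) (i : Fin 2) :
    1 - (δ * ((⌈δ⁻¹⌉ - 1 : ℤ) : ℝ)) ≤ infDist (meshPoint δ ((![⌈δ⁻¹⌉ - 1, 0] : Site 2)))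
      (frontier DobrushinDomain.unitDisc.carrier \ DobrushinDomain.unitDisc.arc i) := by
  rw [le_infDist (nonempty_frontier_diff_unitDisc_arc i)]
  intro z hz
  have hz1 : ‖z‖ = 1 := by
    have := hz.1
    rw [frontier_unitDisc_carrier] at this
    simpa using this
  calc 1 - (δ * ((⌈δ⁻¹⌉ - 1 : ℤ) : ℝ)) = ‖z‖ - ‖meshPoint δ ((![⌈δ⁻¹⌉ - 1, 0] : Site 2))‖ := by
        rw [hz1, norm_meshPoint_lastRealSite hδ]
    _ ≤ ‖z - meshPoint δ ((![⌈δ⁻¹⌉ - 1, 0] : Site 2))‖ := norm_sub_norm_le _ _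
    _ = dist (meshPoint δ ((![⌈δ⁻¹⌉ - 1, 0] : Site 2))) z := by rw [dist_eq_norm, norm_sub_rev]

/-- **The canonical square-lattice Dobrushin data of the unit disc are admissible at no mesh**:
for every `δ`, `¬ (dobrushinData DobrushinDomain.unitDisc δ).IsZdAdmissible`. For `δ > 0` the
last real site `v_δ` is a `zdBoundary` site at least as close to each arc as to the complementary
boundary part, hence lies in both discrete arcs `zdArcA`, `zdArcB`, contradicting
`IsZdAdmissible.disjoint`; for `δ ≤ 0`, `IsZdAdmissible.delta_pos` fails. (Review r02345B,
item 1, made a theorem; Smirnov 2001, §2, for the discrete-arc recipe.) [folklore] -/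
theorem not_isZdAdmissible_dobrushinData_unitDisc (δ : ℝ) :
    ¬ (dobrushinData DobrushinDomain.unitDisc δ).IsZdAdmissible := by
  intro h
  have hδ : 0 < δ := h.delta_pos
  have hA : (![⌈δ⁻¹⌉ - 1, 0] : Site 2) ∈ (dobrushinData DobrushinDomain.unitDisc δ).zdArcA :=
    ⟨lastRealSite_mem_zdBoundary hδ,
      (infDist_lastRealSite_arc_le hδ 0).trans (le_infDist_lastRealSite_frontier_diff hδ 0)⟩
  have hB : (![⌈δ⁻¹⌉ - 1, 0] : Site 2) ∈ (dobrushinData DobrushinDomain.unitDisc δ).zdArcB :=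
    ⟨lastRealSite_mem_zdBoundary hδ,
      (infDist_lastRealSite_arc_le hδ 1).trans (le_infDist_lastRealSite_frontier_diff hδ 1)⟩
  exact Set.disjoint_left.1 h.disjoint hA hB

/-- Consequently the admissibility guard of crit-perc.S02/S26,
`∀ᶠ δ in 𝓝[>] 0, (dobrushinData D δ).IsZdAdmissible`, **fails for the unit disc**. [folklore] -/
theorem not_eventually_isZdAdmissible_dobrushinData_unitDisc :
    ¬ ∀ᶠ δ in 𝓝[>] (0 : ℝ), (dobrushinData DobrushinDomain.unitDisc δ).IsZdAdmissible := fun h ↦ by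
  obtain ⟨δ, hδ⟩ := h.exists
  exact not_isZdAdmissible_dobrushinData_unitDisc δ hδ

/-- **`SLE6LimitZ2` is vacuous at the unit disc**: its instance `D = DobrushinDomain.unitDisc`
(guard `→` convergence of the canonical bond interface to SLE₆ in the disc) holds trivially,
because the guard is false — whatever the truth of the percolation conjecture. This is the
statement concern motivating `SLE6LimitZ2AllDiscretisations`
(`InterfaceScalingLimitDiscretised.lean`). [folklore] -/
theorem sle6LimitZ2_unitDisc_vacuous :
    (∀ᶠ δ in 𝓝[>] (0 : ℝ), (dobrushinData DobrushinDomain.unitDisc δ).IsZdAdmissible) →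
      ConvergesInLawToSLE 6 DobrushinDomain.unitDisc (Ωδ := fun _ ↦ BondConfig (Site 2))
        (bondInterface DobrushinDomain.unitDisc) fun _ ↦ bondPercolation (zdGraph 2) half :=
  fun h ↦ (not_eventually_isZdAdmissible_dobrushinData_unitDisc h).elim

/-- The Dobrushin chord `(0, 2)` of the library's conformal rectangle `ConformalRectangle.unitDisc`
(marks `1, i, -1, -i`) — the Dobrushin domain `(𝔻; 1, -1)` whose exploration interface decides the
crossing `(ab)_δ ↔ (cd)_δ` of that rectangle — is `DobrushinDomain.unitDisc`: both are the unit
disc with mark parameters `0, 1/2`. (Werner 2007, §3: the crossing event of `(Ω; a, b, c, d)` read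
off the interface of `(Ω; a, c)`.) [folklore] -/
theorem conformalRectangle_unitDisc_chord_zero_two :
    ConformalRectangle.unitDisc.chord 0 2 (by decide) = DobrushinDomain.unitDisc := by
  unfold MarkedDomain.chord ConformalRectangle.unitDisc DobrushinDomain.unitDisc
  rfl

/-- Hence the admissibility guard of crit-perc.S02 fails on the chord `(0, 2)` of the unit-disc
conformal rectangle as well: the canonical-data form `SLE6LimitZ2` supplies no SLE₆ input for the
chord on which Cardy's formula for `ConformalRectangle.unitDisc` would be read off — the statement
concern behind the transfer items `SLE6LimitZ2 → CardyFormulaZ2` of the `CardyFormulaZ2` theses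
(cf. `InterfaceScalingLimitDiscretised.lean`, §2). [folklore] -/
theorem not_eventually_isZdAdmissible_dobrushinData_unitDisc_chord :
    ¬ ∀ᶠ δ in 𝓝[>] (0 : ℝ),
      (dobrushinData (ConformalRectangle.unitDisc.chord 0 2 (by decide)) δ).IsZdAdmissible := by
  rw [conformalRectangle_unitDisc_chord_zero_two]
  exact not_eventually_isZdAdmissible_dobrushinData_unitDisc

end CritPerc

end Literature.Probability.Percolation
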